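import Literature.Probability.LatticeModels.SixVertexSpectralFTransform

/-!
# Six-vertex spectral measures: the function `Ξ(s) = s F(s,0)` is bounded (DKLM 2026, Part II §1.5)

H. Duminil-Copin, K. K. Kozlowski, P. Lammers, I. Manolescu, *Gaussian free field convergence of
the six-vertex model with `-1 ≤ Δ ≤ -1/2`*, arXiv:2603.06268 (2026) [DKLM2026SixVertexGFF]
(`paper:arxiv-2603.06268`, chunk p0029):

> `Ξ : ℝ_{>0} → ℝ_{≥0}, s ↦ -s I_F'(s) = s F(s,0)`. Note that `I_F(s) ∝ -log s` if and only if `Ξ`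
> is constant. […] **Theorem 46.** For any convergence sequence `(δ_n)_n`, the function `Ξ` is
> bounded and `-Ξ'(s) = s ΔI_F(|u|)|_{u=se₁} = s ∫ (a²-b²) e^{-as} dμ(a,b) ≥ 0`. […]
> *Proof.* To see that `Ξ` is bounded, recall from the definitions that `Ξ(s) = s ∫ a e^{-as} dμ(a,b)`.
> The bounds on `μ ∈ 𝓜` thus imply that `Ξ` is bounded.

This file defines `Ξ` (`dklmXi`) for the `F`-transform of a measure (`dklmF`, Definition 36) and
proves the **first assertion of Theorem 46** for every `μ ∈ 𝓜_{c,C}`: `|Ξ(s)| ≤ 24 C` for all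
`s > 0` (`abs_dklmXi_le`). The proof makes "the bounds on `μ ∈ 𝓜`" explicit through the scale
invariance of `𝓜_{c,C}` (`scaleMeasure_mem_dklmSpaceM`): `s a e^{-sa} ≤ 2 (sa ∧ 1/(sa))` and
`∫ (sa ∧ 1/(sa)) dμ = ∫ (a ∧ 1/a) dμ^{(1/s)} ≤ 12 C` (`dklmSpaceM_lintegral_min_inv_le`). The
derivative formula (eq. (non-increasing)) depends on Lemma 47 and the rotational invariance and
is not reproduced here.

## References

* H. Duminil-Copin, K. K. Kozlowski, P. Lammers, I. Manolescu, arXiv:2603.06268 (2026), Part II,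
  §1.5, eq. (def Xi) and Theorem 46. [DKLM2026SixVertexGFF]
-/

noncomputable section

open MeasureTheory Set Filter Topology

namespace Literature.Probability.LatticeModels.SixVertex

/-- **`Ξ(s) := -s I_F'(s) = s F(s,0)`** (eq. (def Xi) of Part II §1.5; `F(s,0)` is real,
`dklmF_ofReal_zero`). [cite: DKLM2026SixVertexGFF, Part II §1.5, eq. (def Xi)] -/
def dklmXi (μ : Measure (ℝ × ℝ)) (s : ℝ) : ℝ := s * (dklmF μ s 0).re

/-- `t e^{-t} ≤ 2 (t ∧ 1/t)` for `t > 0`. [folklore] -/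
theorem mul_exp_neg_le_two_mul_min_inv {t : ℝ} (ht : 0 < t) : t * Real.exp (-t) ≤ 2 * min t t⁻¹ := by
  rcases le_or_gt t 1 with h1 | h1
  · have hinv : t ≤ t⁻¹ := h1.trans (one_le_inv_iff₀.2 ⟨ht, h1⟩)
    rw [min_eq_left hinv]
    have : Real.exp (-t) ≤ 1 := Real.exp_le_one_iff.2 (by linarith)
    nlinarith
  · have hinv : t⁻¹ ≤ t := (inv_le_one_of_one_le₀ h1.le).trans h1.le
    rw [min_eq_right hinv]
    have h2 := sq_le_two_mul_exp ht.le
    rw [Real.exp_neg, ← div_eq_mul_inv, div_le_iff₀ (Real.exp_pos t),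
      show 2 * t⁻¹ * Real.exp t = (2 * Real.exp t) / t by ring, le_div_iff₀ ht]
    nlinarith

section Xi

variable {c C : ℝ} {μ : Measure (ℝ × ℝ)}

/-- Scaling out `s`: `∫ (sa ∧ 1/(sa)) dμ = ∫ (a ∧ 1/a) dμ^{(1/s)}`. [cite: DKLM2026SixVertexGFF, Part II, Definition 29] -/
theorem lintegral_min_inv_smul (μ : Measure (ℝ × ℝ)) (s : ℝ) :
    ∫⁻ p, ENNReal.ofReal (min (s * p.1) (s * p.1)⁻¹) ∂μ =
      ∫⁻ p, ENNReal.ofReal (min p.1 p.1⁻¹) ∂scaleMeasure s⁻¹ μ := by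
  rw [scaleMeasure, lintegral_map measurable_min_inv.ennreal_ofReal (measurable_smul_pair _)]
  simp [inv_inv, Prod.smul_fst, smul_eq_mul]

/-- **Theorem 46, first assertion: `Ξ` is bounded on `(0,∞)`** — explicitly `|Ξ(s)| ≤ 24 C` for
`μ ∈ 𝓜_{c,C}` (`C ≥ 0`; in general `24 max(C,0)`). [cite: DKLM2026SixVertexGFF, Part II, Theorem 46] -/
theorem abs_dklmXi_le (h : μ ∈ dklmSpaceM c C) {s : ℝ} (hs : 0 < s) : |dklmXi μ s| ≤ 24 * max C 0 := by
  have hpos := dklmSpaceM_ae_pos h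
  -- `Ξ(s) = ∫ s a e^{-as} dμ`
  have hXi : dklmXi μ s = ∫ p, s * (p.1 * Real.exp (-(p.1 * s))) ∂μ := by
    rw [dklmXi, dklmF_ofReal_zero μ s, Complex.ofReal_re, integral_const_mul]
  have hnn : 0 ≤ᵐ[μ] fun p : ℝ × ℝ => s * (p.1 * Real.exp (-(p.1 * s))) := by
    filter_upwards [hpos] with p hp
    exact mul_nonneg hs.le (mul_nonneg hp.le (Real.exp_pos _).le)
  have hmeas : AEStronglyMeasurable (fun p : ℝ × ℝ => s * (p.1 * Real.exp (-(p.1 * s)))) μ :=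
    (Continuous.aestronglyMeasurable (by fun_prop))
  rw [hXi, abs_of_nonneg (integral_nonneg_of_ae hnn), integral_eq_lintegral_of_nonneg_ae hnn hmeas]
  -- pointwise `s a e^{-as} ≤ 2 (sa ∧ 1/(sa))`, then scale invariance of `𝓜`
  have hpt : ∀ᵐ p ∂μ, ENNReal.ofReal (s * (p.1 * Real.exp (-(p.1 * s)))) ≤
      2 * ENNReal.ofReal (min (s * p.1) (s * p.1)⁻¹) := by
    filter_upwards [hpos] with p hp
    rw [show s * (p.1 * Real.exp (-(p.1 * s))) = (s * p.1) * Real.exp (-(s * p.1)) by ring_nf,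
      show (2 : ENNReal) = ENNReal.ofReal 2 by norm_num, ← ENNReal.ofReal_mul (by norm_num)]
    exact ENNReal.ofReal_le_ofReal (mul_exp_neg_le_two_mul_min_inv (mul_pos hs hp))
  have hscale := dklmSpaceM_lintegral_min_inv_le (scaleMeasure_mem_dklmSpaceM (inv_pos.2 hs) h)
  have hle : ∫⁻ p, ENNReal.ofReal (s * (p.1 * Real.exp (-(p.1 * s)))) ∂μ ≤ 24 * ENNReal.ofReal C := by
    calc ∫⁻ p, ENNReal.ofReal (s * (p.1 * Real.exp (-(p.1 * s)))) ∂μ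
        ≤ ∫⁻ p, 2 * ENNReal.ofReal (min (s * p.1) (s * p.1)⁻¹) ∂μ := lintegral_mono_ae hpt
      _ = 2 * ∫⁻ p, ENNReal.ofReal (min p.1 p.1⁻¹) ∂scaleMeasure s⁻¹ μ := by
          rw [lintegral_const_mul _ (by fun_prop), lintegral_min_inv_smul μ s]
      _ ≤ 2 * (12 * ENNReal.ofReal C) := by gcongr
      _ = 24 * ENNReal.ofReal C := by ring
  have hfin : (24 : ENNReal) * ENNReal.ofReal C ≠ ⊤ := ENNReal.mul_ne_top (by norm_num) ENNReal.ofReal_ne_top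
  calc (∫⁻ p, ENNReal.ofReal (s * (p.1 * Real.exp (-(p.1 * s)))) ∂μ).toReal
      ≤ ((24 : ENNReal) * ENNReal.ofReal C).toReal := ENNReal.toReal_mono hfin hle
    _ = 24 * max C 0 := by rw [ENNReal.toReal_mul, ENNReal.toReal_ofReal']; norm_num

end Xi

end Literature.Probability.LatticeModels.SixVertex

end
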